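import Mathlib
import Summits.MatrixMultiplication.MatrixMultiplication.Theorems.SoloInformedCwTwoMonomialDoor

/-!
# Door D6, self-similar designs: the integer sumset conjecture closes every nested digit family

Solo-informed seat, door D6 (weighted digit designs of `S_N = supp(T_{cw,2}^{⊠N})` in abelian groups;
`SoloInformedCwTwoMonomialDoor`: such a design in `B` gives `bR(T_{cw,2}^{⊠N}) ≤ |B|`, and designs of
order `≤ (3+ε)^N` for every `ε` would give `ω = 2`).  The finite census (`N ≤ 3`) cannot see infinite
families.  The simplest infinite families are SELF-SIMILAR: a block of `t` digit pairs
`(p j, q j) ∈ ℤ²` repeated at the scales `r^k`, `k < L` (`nestedDigits p q r L`, `L·t` coordinates),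
hosted without wrap-around in `ℤ/(g·r^L)`; if every depth is a weighted design the family certifies
`bR(T_{cw,2}^{⊠ tL}) ≤ g·r^L` for all `L`, i.e. rate `r^{1/t}` per coordinate, and a rate `< 4` would
refute CONJECTURE D6-CLOSURE (`|B| ≥ 4^N`).

This file types the two statements the seat's gen-9 computations single out and proves the
reduction between them:

* `IntegerSumsetConjecture` (ISC): for every weighted digit design with INTEGER digits
  (`N` coordinates, digit-sum set `A ⊂ ℤ`), `4^(N+1) - 1 ≤ 3·|A + A|`; equality for the base-`4`
  block `{0,1,2}·4^k` (`|A+A| = |{base-4 numerals with digits ≤ 4}| = (4^(N+1)-1)/3`).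
  Evidence (not used here): exhaustive for `N = 2` with digits `≤ 18` and sampled for digits `≤ 60`
  (`4.4·10^5` designs, minimum `21`), sampled for `N = 3` (`3·10^4` designs, digits `≤ 40`, minimum
  `89 ≥ 85`; hill-climbing returns the base-`4` block, `85`).
* `NestedClosure`: no self-similar integer family has rate `< 4`: if every depth-`L` nested table of a
  `t`-block at base `r ≥ 2` is a weighted design then `4^t ≤ r`.
* `nestedClosure_of_integerSumsetConjecture : IntegerSumsetConjecture → NestedClosure` — the digit
  sums of the depth-`L` table lie in an interval of length `≤ 2·M·r^L` (`M = Σ_j (|p j| + |q j|)`), so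
  `|A_L + A_L| ≤ 4·M·r^L + 1`, while ISC gives `|A_L + A_L| ≥ 4^{tL}`; `L → ∞`.
* `card_le_of_groupSumsetBound`: the abelian-group form `c·4^N ≤ |A + A|` gives `c·4^N ≤ |B|`
  outright (`A + A ⊆ B`), i.e. D6-CLOSURE up to the constant `c`, which suffices to shut door D6.

No `sorry`; axioms `propext`, `Classical.choice`, `Quot.sound`.
References: J. Alman, V. Vassilevska Williams, arXiv:1810.08671, Thm 7.2 (the base-`4` design);
A. Conner, F. Gesmundo, J.M. Landsberg, E. Ventura, arXiv:1909.04785, §2.2 (`T_{cw,2}`).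
-/

noncomputable section

open scoped BigOperators Pointwise

namespace Summit.MatrixMultiplication.MatrixMultiplication.Theorems

section SelfSimilar

variable {N : ℕ}

/-- The weighted-digit-design predicate of the door file, for digits in any additive commutative
group `B` and natural weights `a`. [cite: AlmanVassilevskaWilliams2018, Thm. 7.2] -/
def IsWeightedDesign {B : Type*} [AddCommGroup B] (f : Fin N → Fin 3 → B)
    (a : Fin N → Fin 3 → ℕ) : Prop :=
  ∀ u v w : Fin N → Fin 3,
    wordSum f u + wordSum f v + wordSum f w = ∑ k, (f k 0 + f k 1 + f k 2) →
      (∀ k, u k ≠ v k ∧ u k ≠ w k ∧ v k ≠ w k) ∨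
        ∑ k, (a k 0 + a k 1 + a k 2) < wordWt a u + wordWt a v + wordWt a w

/-- The digit-sum set `A = {P(u)}` of a digit table. [cite: AlmanVassilevskaWilliams2018, Thm. 7.2] -/
def digitSumSet {B : Type*} [AddCommGroup B] [DecidableEq B] (f : Fin N → Fin 3 → B) : Finset B :=
  Finset.univ.image (wordSum f)

/-- **Integer sumset conjecture (ISC, this seat, gen 9).**  Every weighted digit design with integer
digits satisfies `4^(N+1) - 1 ≤ 3·|A + A|`.  (Conjecture; stated as a `Prop`, never assumed globally.) -/
def IntegerSumsetConjecture : Prop :=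
  ∀ (N : ℕ) (f : Fin N → Fin 3 → ℤ) (a : Fin N → Fin 3 → ℕ), IsWeightedDesign f a →
    4 ^ (N + 1) - 1 ≤ 3 * (digitSumSet f + digitSumSet f).card

/-- The depth-`L` nested (self-similar) digit table of the block `(p, q)` at base `r`:
coordinate `(k, j)` (`k < L` the scale, `j < t` the position in the block) carries the digits
`(0, r^k·p j, r^k·q j)`. -/
def nestedDigits {t : ℕ} (p q : Fin t → ℤ) (r : ℤ) (L : ℕ) : Fin (L * t) → Fin 3 → ℤ :=
  fun i => ![0, r ^ ((finProdFinEquiv.symm i).1 : ℕ) * p (finProdFinEquiv.symm i).2,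
    r ^ ((finProdFinEquiv.symm i).1 : ℕ) * q (finProdFinEquiv.symm i).2]

/-- **Nested closure (conjecture, this seat, gen 9).**  No self-similar integer digit family has rate
below `4`: if every depth of the nested table of a `t`-block (`t ≥ 1`) at base `r ≥ 2` is a weighted
design, then `4^t ≤ r`. -/
def NestedClosure : Prop :=
  ∀ (t : ℕ) (p q : Fin t → ℤ) (r : ℕ), 0 < t → 2 ≤ r →
    (∀ L : ℕ, ∃ a : Fin (L * t) → Fin 3 → ℕ, IsWeightedDesign (nestedDigits p q (r : ℤ) L) a) →
      4 ^ t ≤ r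

/-! ### The interval bound for nested digit sums -/

/-- The size of the block: `M = Σ_j (|p j| + |q j|)`. -/
def blockSize {t : ℕ} (p q : Fin t → ℤ) : ℕ := ∑ j, ((p j).natAbs + (q j).natAbs)

/-- Each nested digit at scale `k`, position `j` has absolute value `≤ r^k·(|p j| + |q j|)`. -/
theorem abs_nestedDigits_le {t : ℕ} (p q : Fin t → ℤ) (r : ℕ) (L : ℕ) (i : Fin (L * t))
    (x : Fin 3) :
    |nestedDigits p q (r : ℤ) L i x| ≤
      (r : ℤ) ^ ((finProdFinEquiv.symm i).1 : ℕ) *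
        (((p (finProdFinEquiv.symm i).2).natAbs : ℤ) + ((q (finProdFinEquiv.symm i).2).natAbs : ℤ)) := by
  set k : ℕ := ((finProdFinEquiv.symm i).1 : ℕ)
  set j : Fin t := (finProdFinEquiv.symm i).2
  have hr : (0 : ℤ) ≤ (r : ℤ) ^ k := by positivity
  have hp : |p j| = ((p j).natAbs : ℤ) := Int.abs_eq_natAbs _
  have hq : |q j| = ((q j).natAbs : ℤ) := Int.abs_eq_natAbs _
  have hp0 : (0 : ℤ) ≤ ((p j).natAbs : ℤ) := Int.natCast_nonneg _
  have hq0 : (0 : ℤ) ≤ ((q j).natAbs : ℤ) := Int.natCast_nonneg _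
  have h0 : nestedDigits p q (r : ℤ) L i 0 = 0 := rfl
  have h1 : nestedDigits p q (r : ℤ) L i 1 = (r : ℤ) ^ k * p j := rfl
  have h2 : nestedDigits p q (r : ℤ) L i 2 = (r : ℤ) ^ k * q j := rfl
  fin_cases x
  · show |nestedDigits p q (r : ℤ) L i 0| ≤ _
    rw [h0, abs_zero]; positivity
  · show |nestedDigits p q (r : ℤ) L i 1| ≤ _
    rw [h1, abs_mul, abs_of_nonneg hr, hp]; nlinarith
  · show |nestedDigits p q (r : ℤ) L i 2| ≤ _
    rw [h2, abs_mul, abs_of_nonneg hr, hq]; nlinarith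

/-- Sum of the per-coordinate bounds: `Σ_{k<L} r^k · M ≤ M · r^L` for `r ≥ 2`. -/
theorem sum_bound_le {t : ℕ} (p q : Fin t → ℤ) (r : ℕ) (hr : 2 ≤ r) (L : ℕ) :
    ∑ i : Fin (L * t), (r : ℤ) ^ ((finProdFinEquiv.symm i).1 : ℕ) *
        (((p (finProdFinEquiv.symm i).2).natAbs : ℤ) + ((q (finProdFinEquiv.symm i).2).natAbs : ℤ))
      ≤ (blockSize p q : ℤ) * (r : ℤ) ^ L := by
  -- reindex over Fin L × Fin t
  rw [Fintype.sum_equiv finProdFinEquiv.symm _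
        (fun kj : Fin L × Fin t => (r : ℤ) ^ (kj.1 : ℕ) *
          (((p kj.2).natAbs : ℤ) + ((q kj.2).natAbs : ℤ))) (fun i => rfl)]
  rw [Fintype.sum_prod_type]
  have hgeom : ∀ L : ℕ, ∑ k : Fin L, (r : ℤ) ^ (k : ℕ) ≤ (r : ℤ) ^ L := by
    intro L
    induction L with
    | zero => simp
    | succ n ih =>
      rw [Fin.sum_univ_castSucc]
      simp only [Fin.val_castSucc, Fin.val_last]
      have h2 : (2 : ℤ) ≤ r := by exact_mod_cast hr
      have hpos : (0 : ℤ) ≤ (r : ℤ) ^ n := by positivity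
      calc ∑ k : Fin n, (r : ℤ) ^ (k : ℕ) + (r : ℤ) ^ n ≤ (r : ℤ) ^ n + (r : ℤ) ^ n := by linarith [ih]
        _ = 2 * (r : ℤ) ^ n := by ring
        _ ≤ (r : ℤ) * (r : ℤ) ^ n := by gcongr
        _ = (r : ℤ) ^ (n + 1) := by ring
  have hM : ((blockSize p q : ℕ) : ℤ) = ∑ j : Fin t, (((p j).natAbs : ℤ) + ((q j).natAbs : ℤ)) := by
    simp [blockSize]
  have hM0 : (0 : ℤ) ≤ ∑ j : Fin t, (((p j).natAbs : ℤ) + ((q j).natAbs : ℤ)) := by positivity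
  calc ∑ k : Fin L, ∑ j : Fin t, (r : ℤ) ^ (k : ℕ) * (((p j).natAbs : ℤ) + ((q j).natAbs : ℤ))
      = ∑ k : Fin L, (r : ℤ) ^ (k : ℕ) * ∑ j : Fin t, (((p j).natAbs : ℤ) + ((q j).natAbs : ℤ)) := by
        simp [Finset.mul_sum]
    _ = (∑ k : Fin L, (r : ℤ) ^ (k : ℕ)) * ∑ j : Fin t, (((p j).natAbs : ℤ) + ((q j).natAbs : ℤ)) := by
        rw [Finset.sum_mul]
    _ ≤ (r : ℤ) ^ L * ∑ j : Fin t, (((p j).natAbs : ℤ) + ((q j).natAbs : ℤ)) :=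
        mul_le_mul_of_nonneg_right (hgeom L) hM0
    _ = (blockSize p q : ℤ) * (r : ℤ) ^ L := by rw [hM, mul_comm]

/-- Every nested digit sum lies in `[-M·r^L, M·r^L]`. -/
theorem abs_wordSum_nestedDigits_le {t : ℕ} (p q : Fin t → ℤ) (r : ℕ) (hr : 2 ≤ r) (L : ℕ)
    (u : Fin (L * t) → Fin 3) :
    |wordSum (nestedDigits p q (r : ℤ) L) u| ≤ (blockSize p q : ℤ) * (r : ℤ) ^ L := by
  unfold wordSum
  refine (Finset.abs_sum_le_sum_abs _ _).trans ((Finset.sum_le_sum fun i _ => ?_).trans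
    (sum_bound_le p q r hr L))
  exact abs_nestedDigits_le p q r L i (u i)

/-- Hence `|A_L + A_L| ≤ 4·M·r^L + 1`. -/
theorem card_sumset_nestedDigits_le {t : ℕ} (p q : Fin t → ℤ) (r : ℕ) (hr : 2 ≤ r) (L : ℕ) :
    ((digitSumSet (nestedDigits p q (r : ℤ) L) + digitSumSet (nestedDigits p q (r : ℤ) L)).card : ℤ)
      ≤ 4 * ((blockSize p q : ℤ) * (r : ℤ) ^ L) + 1 := by
  set K : ℤ := (blockSize p q : ℤ) * (r : ℤ) ^ L with hK
  have hK0 : 0 ≤ K := by positivity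
  have hsub : digitSumSet (nestedDigits p q (r : ℤ) L) + digitSumSet (nestedDigits p q (r : ℤ) L) ⊆
      Finset.Icc (-(2 * K)) (2 * K) := by
    intro z hz
    rw [Finset.mem_add] at hz
    obtain ⟨x, hx, y, hy, rfl⟩ := hz
    simp only [digitSumSet, Finset.mem_image, Finset.mem_univ, true_and] at hx hy
    obtain ⟨u, rfl⟩ := hx
    obtain ⟨v, rfl⟩ := hy
    have hu := abs_wordSum_nestedDigits_le p q r hr L u
    have hv := abs_wordSum_nestedDigits_le p q r hr L v
    rw [abs_le] at hu hv
    rw [Finset.mem_Icc]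
    constructor <;> linarith [hu.1, hu.2, hv.1, hv.2]
  calc ((digitSumSet (nestedDigits p q (r : ℤ) L) + digitSumSet (nestedDigits p q (r : ℤ) L)).card : ℤ)
      ≤ ((Finset.Icc (-(2 * K)) (2 * K)).card : ℤ) := by exact_mod_cast Finset.card_le_card hsub
    _ = 2 * K + 1 - -(2 * K) := by
        rw [Int.card_Icc]; rw [Int.toNat_of_nonneg (by linarith)]
    _ = 4 * K + 1 := by ring

/-! ### The reduction -/

/-- **ISC ⟹ NESTED CLOSURE.**  If the integer sumset conjecture holds, no self-similar integer digit
family certifies a rate below `4` (so none can open door D6). -/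
theorem nestedClosure_of_integerSumsetConjecture (hISC : IntegerSumsetConjecture) : NestedClosure := by
  intro t p q r ht hr hdes
  -- for every L : 4^(L t + 1) - 1 ≤ 3 (4 M r^L + 1)
  have hL : ∀ L : ℕ, (4 : ℝ) ^ (L * t) ≤ (3 * blockSize p q + 1 : ℝ) * (r : ℝ) ^ L := by
    intro L
    obtain ⟨a, ha⟩ := hdes L
    have h1 := hISC (L * t) _ a ha
    have h2 := card_sumset_nestedDigits_le p q r hr L
    have h3 : (4 : ℤ) ^ (L * t + 1) - 1 ≤ 3 * (4 * ((blockSize p q : ℤ) * (r : ℤ) ^ L) + 1) := by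
      have : ((4 : ℕ) ^ (L * t + 1) - 1 : ℕ) = ((4 : ℤ) ^ (L * t + 1) - 1 : ℤ) := by
        have h4 : 1 ≤ 4 ^ (L * t + 1) := Nat.one_le_pow _ _ (by norm_num)
        push_cast [Nat.cast_sub h4]; ring
      have h1' : (((4 : ℕ) ^ (L * t + 1) - 1 : ℕ) : ℤ) ≤
          ((3 * (digitSumSet (nestedDigits p q (r:ℤ) L) + digitSumSet (nestedDigits p q (r:ℤ) L)).card : ℕ) : ℤ) := by
        exact_mod_cast h1
      rw [this] at h1'
      push_cast at h1'
      linarith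
    -- 4^(Lt+1) = 4 * 4^(Lt) ; r^L ≥ 1
    have hrL : (1 : ℤ) ≤ (r : ℤ) ^ L := one_le_pow₀ (by exact_mod_cast (by omega : 1 ≤ r))
    have h4 : (4 : ℤ) * 4 ^ (L * t) ≤ 12 * (blockSize p q : ℤ) * (r : ℤ) ^ L + 4 * (r : ℤ) ^ L := by
      have : (4 : ℤ) ^ (L * t + 1) = 4 * 4 ^ (L * t) := by ring
      nlinarith [h3, hrL]
    have h5 : (4 : ℤ) ^ (L * t) ≤ (3 * (blockSize p q : ℤ) + 1) * (r : ℤ) ^ L := by nlinarith [h4]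
    exact_mod_cast h5
  -- if r < 4^t then (r / 4^t)^L → 0, contradiction
  by_contra hlt
  push Not at hlt
  set C : ℝ := 3 * blockSize p q + 1 with hC
  have hCpos : 0 < C := by rw [hC]; positivity
  have hrpos : (0 : ℝ) < r := by exact_mod_cast (by omega : 0 < r)
  have h4t : (0 : ℝ) < (4 : ℝ) ^ t := by positivity
  have hy : (r : ℝ) / (4 : ℝ) ^ t < 1 := by
    rw [div_lt_one h4t]; exact_mod_cast hlt
  have hy0 : 0 < (r : ℝ) / (4 : ℝ) ^ t := div_pos hrpos h4t
  obtain ⟨n, hn⟩ := exists_pow_lt_of_lt_one (inv_pos.mpr hCpos) hy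
  -- hn : (r / 4^t)^n < C⁻¹ ; hL n : 4^(n t) ≤ C r^n
  have hLn := hL n
  have hpow : ((r : ℝ) / (4 : ℝ) ^ t) ^ n = (r : ℝ) ^ n / (4 : ℝ) ^ (n * t) := by
    rw [div_pow, ← pow_mul, mul_comm]
  rw [hpow, div_lt_iff₀ (by positivity)] at hn
  -- hn : r^n < C⁻¹ * 4^(n t)
  have : C * (r : ℝ) ^ n < (4 : ℝ) ^ (n * t) := by
    calc C * (r : ℝ) ^ n < C * (C⁻¹ * (4 : ℝ) ^ (n * t)) := by gcongr
      _ = (4 : ℝ) ^ (n * t) := by field_simp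
  linarith

/-- **Group form.**  A sumset lower bound `c·4^N ≤ |A + A|` for weighted digit designs in finite abelian
groups gives `c·4^N ≤ |B|` at once, since `A + A ⊆ B`: this is how an additive-combinatorial proof of
the sumset bound would shut door D6. -/
theorem card_le_of_groupSumsetBound {B : Type*} [AddCommGroup B] [Fintype B] [DecidableEq B]
    (c : ℝ) (f : Fin N → Fin 3 → B)
    (h : c * 4 ^ N ≤ ((digitSumSet f + digitSumSet f).card : ℝ)) :
    c * 4 ^ N ≤ (Fintype.card B : ℝ) :=
  h.trans (by exact_mod_cast Finset.card_le_univ _)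

/-! ### Non-vacuity and tightness at `N = 1` -/

/-- The base-`4` block `{0,1,2} ⊂ ℤ` (one coordinate). [cite: AlmanVassilevskaWilliams2018, Thm. 7.2] -/
def baseFourDigitsInt : Fin 1 → Fin 3 → ℤ := fun _ => ![0, 1, 2]

/-- `{0,1,2} ⊂ ℤ` with the AVW weights `(0,1,0)` is a weighted digit design (the only off-`S_1`
solution of `x + y + z = 3` in digits is `(1,1,1)`, of weight `3 > 1`): `IsWeightedDesign` is inhabited
over `ℤ`, and every depth of its nested family at base `4` is the AVW design read in `ℤ`.
[cite: AlmanVassilevskaWilliams2018, Thm. 7.2] -/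
theorem isWeightedDesign_baseFour_one : IsWeightedDesign baseFourDigitsInt avwWeights := by
  intro u v w
  simp only [wordSum, wordWt, baseFourDigitsInt, avwWeights, Fin.sum_univ_one, Fin.forall_fin_one]
  generalize u 0 = x
  generalize v 0 = y
  generalize w 0 = z
  revert x y z
  decide

/-- ISC is TIGHT at `N = 1`: `|A + A| = |{0,…,4}| = 5 = (4² - 1)/3` for the base-`4` block. -/
theorem card_sumset_baseFour_one :
    (digitSumSet baseFourDigitsInt + digitSumSet baseFourDigitsInt).card = 5 := by
  have hA : digitSumSet baseFourDigitsInt = {0, 1, 2} := by decide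
  rw [hA]; decide

end SelfSimilar

end Summit.MatrixMultiplication.MatrixMultiplication.Theorems
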